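import Literature.AlgebraicGeometry.Resolution.Hironaka1964LocalCompletionRing
import Mathlib.RingTheory.Unramified.LocalRing
import HarnessLib

/-!
# Crux `FrobeniusLadder.FRationalResolution` (stmt-ResolutionOfSingularities-15317), line `redirect`,
# stub `stub_diagonalizableQuotientResolution` — descent of `𝔪`-primary centres along an étale
# chart with trivial residue field extension

The stub presents `X` by ÉTALE charts `φ : Spec S₀ → X`. A local resolution of the chart at a point
`v` over a singular `x ∈ X` by the blowing up of an `𝔪_v`-PRIMARY ideal `J ⊆ 𝒪_v` (Kato's toric
resolution of an isolated toric singularity is of this kind) descends to `X` near `x` as soon as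
`J` is EXTENDED from `𝒪_{X,x}`: `J = (J ∩ 𝒪_{X,x}) 𝒪_v` (blowing up commutes with the flat base
change `𝒪_{X,x} → 𝒪_v`, and regularity descends along étale local maps,
`isRegularLocalRing_iff_of_etaleLocal`). This file proves the ring statement behind it:

* `exists_sub_mem_map_pow` — if `f : A → B`, `𝔫 ⊆ 𝔪B` and every element of `B` is congruent to an
  element of `f(A)` modulo `𝔫` (residue surjectivity), then every element of `B` is congruent to an
  element of `f(A)` modulo `𝔪ᵏB`, for every `k`;
* `map_comap_eq_of_pow_le` — hence every ideal `J ⊇ 𝔪ᵏB` is extended: `(f⁻¹J)B = J`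
  (`Ideal.map_comap_eq_of_forall_sub_mem`), and `𝔪ᵏ ⊆ f⁻¹J`;
* `map_comap_eq_of_maximalIdeal_pow_le` — for an UNRAMIFIED local homomorphism of local rings
  (`Algebra.FormallyUnramified`, essentially of finite type: `𝔪_A B = 𝔪_B`) with TRIVIAL residue
  field extension, every `𝔪_B`-primary ideal (`𝔪_Bᵏ ⊆ J`) is extended from the `𝔪_A`-primary
  ideal `f⁻¹J ⊇ 𝔪_Aᵏ`. No flatness is needed.

Honest label: one brick of the local step for ISOLATED diagonalizable quotient singularities (the
case `κ(v) = κ(x)`; a separable residue extension needs in addition Galois descent of the centre,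
`Ideal.map_comap_eq_of_forall_map_le`). No definitions, no named facts, no sorry.
[folklore; cite: StacksProject, Tag 00UW (unramified local algebras); Tag 05D8]
-/

noncomputable section

-- single-problem summit: the doubled namespace component is forced
set_option linter.dupNamespace false

open IsLocalRing

namespace Summit.ResolutionOfSingularities.ResolutionOfSingularities.Theorems.FRationalResolution.PrimaryDescent

universe u v

section Ring

variable {A : Type u} {B : Type v} [CommRing A] [CommRing B] (f : A →+* B)

/-- **Residue surjectivity propagates to all infinitesimal neighbourhoods.** If `𝔫 ⊆ 𝔪B` and every
`b ∈ B` is congruent modulo `𝔫` to some `f a`, then every `b ∈ B` is congruent modulo `𝔪ᵏB` to some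
`f a`, for every `k` (induction on `k`: write an element of `𝔪ᵏB` as a `B`-combination of `f(𝔪ᵏ)`
and approximate the coefficients modulo `𝔫 ⊆ 𝔪B`). [folklore] -/
theorem exists_sub_mem_map_pow (𝔪 : Ideal A) (𝔫 : Ideal B) (hn : 𝔫 ≤ 𝔪.map f)
    (hres : ∀ b : B, ∃ a : A, b - f a ∈ 𝔫) (k : ℕ) (b : B) :
    ∃ a : A, b - f a ∈ (𝔪 ^ k).map f := by
  induction k generalizing b with
  | zero => exact ⟨0, by rw [pow_zero, Ideal.one_eq_top, Ideal.map_top]; exact Submodule.mem_top⟩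
  | succ k ih =>
    -- every element of `𝔪ᵏB` is congruent to an element of `f(A)` modulo `𝔪ᵏ⁺¹B`
    have key : ∀ x ∈ (𝔪 ^ k).map f, ∃ a : A, x - f a ∈ (𝔪 ^ (k + 1)).map f := by
      intro x hx
      refine Submodule.span_induction (p := fun x _ => ∃ a : A, x - f a ∈ (𝔪 ^ (k + 1)).map f)
        ?_ ?_ ?_ ?_ hx
      · rintro _ ⟨m, hm, rfl⟩
        exact ⟨m, by rw [sub_self]; exact Ideal.zero_mem _⟩
      · exact ⟨0, by rw [map_zero, sub_zero]; exact Ideal.zero_mem _⟩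
      · rintro x y - - ⟨a, ha⟩ ⟨a', ha'⟩
        refine ⟨a + a', ?_⟩
        have : x + y - f (a + a') = (x - f a) + (y - f a') := by rw [map_add]; ring
        rw [this]
        exact Ideal.add_mem _ ha ha'
      · rintro c x hx ⟨a, ha⟩
        obtain ⟨a_c, hc⟩ := hres c
        -- `c • x = f(a_c a)·… `: split `c = f a_c + (c - f a_c)` and `x = f a + (x - f a)`
        refine ⟨a_c * a, ?_⟩
        have hsplit : c • x - f (a_c * a) =
            f a_c * (x - f a) + (c - f a_c) * x := by
          rw [smul_eq_mul, map_mul]; ring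
        rw [hsplit]
        refine Ideal.add_mem _ (Ideal.mul_mem_left _ _ ha) ?_
        -- `(c - f a_c) ∈ 𝔫 ⊆ 𝔪B` and `x ∈ 𝔪ᵏB`, so the product lies in `𝔪ᵏ⁺¹B`
        have h1 : c - f a_c ∈ 𝔪.map f := hn hc
        have hprod : (c - f a_c) * x ∈ 𝔪.map f * (𝔪 ^ k).map f := Ideal.mul_mem_mul h1 hx
        rw [← Ideal.map_mul, ← pow_succ'] at hprod
        exact hprod
    obtain ⟨a, ha⟩ := ih b
    obtain ⟨a', ha'⟩ := key _ ha
    refine ⟨a + a', ?_⟩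
    have : b - f (a + a') = b - f a - f a' := by rw [map_add]; ring
    rw [this]
    exact ha'

/-- **Ideals above `𝔪ᵏB` are extended**, under residue surjectivity modulo some `𝔫 ⊆ 𝔪B`: every
ideal `J ⊇ 𝔪ᵏB` of `B` satisfies `(f⁻¹J)B = J`, and `f⁻¹J ⊇ 𝔪ᵏ`. [folklore] -/
theorem map_comap_eq_of_pow_le (𝔪 : Ideal A) (𝔫 : Ideal B) (hn : 𝔫 ≤ 𝔪.map f)
    (hres : ∀ b : B, ∃ a : A, b - f a ∈ 𝔫) {J : Ideal B} {k : ℕ} (hJ : (𝔪 ^ k).map f ≤ J) :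
    (J.comap f).map f = J ∧ 𝔪 ^ k ≤ J.comap f :=
  ⟨Literature.AlgebraicGeometry.Resolution.Ideal.map_comap_eq_of_forall_sub_mem f (𝔪 ^ k)
      (exists_sub_mem_map_pow f 𝔪 𝔫 hn hres k) hJ,
    Ideal.map_le_iff_le_comap.mp hJ⟩

end Ring

section Local

variable (A B : Type u) [CommRing A] [CommRing B] [Algebra A B] [IsLocalRing A] [IsLocalRing B]
  [IsLocalHom (algebraMap A B)]

/-- **`𝔪`-primary ideals descend along an unramified local homomorphism with trivial residue
field extension.** Let `A → B` be a local homomorphism of local rings, essentially of finite type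
and formally unramified (so `𝔪_A B = 𝔪_B`, Mathlib `Algebra.FormallyUnramified.map_maximalIdeal`),
whose residue field extension is trivial (every `b ∈ B` is congruent to some `f a` modulo `𝔪_B`).
Then every ideal `J ⊇ 𝔪_Bᵏ` of `B` is extended from `A`: `J = (f⁻¹J)B` with `f⁻¹J ⊇ 𝔪_Aᵏ`.
(The stalk map of an étale morphism at a point with trivial residue extension is such a
homomorphism; `𝔪`-primary blow-up centres on the chart descend.) No flatness is used.
[cite: StacksProject, Tag 00UW] -/
theorem map_comap_eq_of_maximalIdeal_pow_le [Algebra.EssFiniteType A B]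
    [Algebra.FormallyUnramified A B]
    (hres : ∀ b : B, ∃ a : A, b - algebraMap A B a ∈ maximalIdeal B)
    {J : Ideal B} {k : ℕ} (hJ : maximalIdeal B ^ k ≤ J) :
    (J.comap (algebraMap A B)).map (algebraMap A B) = J ∧
      maximalIdeal A ^ k ≤ J.comap (algebraMap A B) := by
  have hmax : (maximalIdeal A).map (algebraMap A B) = maximalIdeal B :=
    Algebra.FormallyUnramified.map_maximalIdeal
  refine map_comap_eq_of_pow_le (algebraMap A B) (maximalIdeal A) (maximalIdeal B) hmax.ge hres ?_
  rw [Ideal.map_pow, hmax]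
  exact hJ

/-- The same, for ideals BETWEEN `𝔪_Bᵏ` and `𝔪_B` (the `𝔪_B`-primary ideals of a Noetherian
local `B` are exactly these, for some `k`): the descended ideal `f⁻¹J` lies between `𝔪_Aᵏ` and
`𝔪_A`. [cite: StacksProject, Tag 00UW] -/
theorem comap_between_of_maximalIdeal_pow_le [Algebra.EssFiniteType A B]
    [Algebra.FormallyUnramified A B]
    (hres : ∀ b : B, ∃ a : A, b - algebraMap A B a ∈ maximalIdeal B)
    {J : Ideal B} {k : ℕ} (hJ : maximalIdeal B ^ k ≤ J) (hJ' : J ≤ maximalIdeal B) :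
    maximalIdeal A ^ k ≤ J.comap (algebraMap A B) ∧ J.comap (algebraMap A B) ≤ maximalIdeal A ∧
      (J.comap (algebraMap A B)).map (algebraMap A B) = J := by
  obtain ⟨hmap, hpow⟩ := map_comap_eq_of_maximalIdeal_pow_le A B hres hJ
  refine ⟨hpow, fun a ha => ?_, hmap⟩
  have hfa : algebraMap A B a ∈ maximalIdeal B := hJ' (Ideal.mem_comap.mp ha)
  rw [IsLocalRing.mem_maximalIdeal, mem_nonunits_iff] at hfa ⊢
  exact fun hu => hfa ((isUnit_map_iff (algebraMap A B) a).mpr hu)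

end Local

end Summit.ResolutionOfSingularities.ResolutionOfSingularities.Theorems.FRationalResolution.PrimaryDescent

end
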